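import Mathlib.Analysis.SpecialFunctions.Integrals.Basic
import Mathlib.MeasureTheory.Integral.Prod
import Literature.Analysis.FluidPDE.PineauVicolOneSlice
import Literature.Analysis.FluidPDE.RescaledEulerLeray
import Literature.Analysis.FluidPDE.AncientSimilarityVariables
import Literature.Analysis.FluidPDE.LocalAffineChainRules
import Literature.Analysis.FluidPDE.SuitableWeak
import HarnessLib

/-!
# Pineau–Vicol 2026, Theorem 1.9 — the printed proof, first steps
  (Remark 1.10: (1.18), (1.17) ⇒ (1.19); §9.1: the geometry of Lemma 9.2; §9.2: the scaling
  glue (9.15)–(9.16) of Prop. 9.5; §9.3: the slice bounds from (1.15)–(1.16))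

Analysis/FluidPDE proof file, sibling of `PineauVicolOneSlice.lean` (the named fact
`Literature.Analysis.FluidPDE.pineauVicol2026_oneSlice_regularity`: B. Pineau, V. Vicol,
arXiv:2607.09619 (2026), Thm. 1.9, "approximately self-similar Type I solutions are regular").
The printed proof (§9, pp. 29–35) works in the backward similarity variables (9.1),
`U(y,s) = √(−t) u(x,t)`, `P(y,s) = (−t) p(x,t)`, `y = x/√(−t)`, `s = −log(−t)` — in the tree the
transforms `lerayOrbit u s y = e^{−s/2} u(−e^{−s}, e^{−s/2} y)` (`HyperbolicDSSOrbit.lean`) and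
`lerayOrbitPressure p s y = e^{−s} p(−e^{−s}, e^{−s/2} y)` (`RescaledEulerLeray.lean`), with the
chain rules of `AncientSimilarityVariables.lean`. This file proves, in that vocabulary and for
the hypotheses of the fact exactly as vendored (`IsClassicalNSSolutionOnRegion` on
`[−1,0) × B₁`, (1.15) on it, (1.16) on the annulus `½ < |x| < ¾`, (1.17) with `timeDerivOn`),
the elementary reductions with which the printed proof opens:

* **(1.18)** (Remark 1.10, p. 8): `∂ₛU(y,s) = √(−t)((−t)∂ₜu − ½u − ½(x·∇)u)(x,t)` at
  `(t,x) = (−e^{−s}, e^{−s/2}y)` whenever `uncurry u` is differentiable at `(t,x)` (from the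
  tree's chain rule `lerayOrbitForce_timeDeriv`) — `timeDeriv_lerayOrbit_eq_selfSimilar`, and
  in `(t,x)`-form `timeDeriv_lerayOrbit_neg_log`.
* **(1.17) ⇒ (1.19)** (p. 8: "condition (1.17) at `t̄ = −e^{−s̄}` is precisely
  `‖∂ₛU(·,s̄)‖_{L^∞(B_{e^{s̄/2}})} ≤ δ₀`"): for a classical solution on the region `[−1,0) × B₁`
  and `−1 < t̄ < 0`, the one-slice hypothesis of the fact at `t̄` gives `‖∂ₛU(y, s̄)‖ ≤ δ₀` for
  all `‖y‖ < e^{s̄/2}`, `s̄ = −log(−t̄)` — `pineauVicol_oneSlice_hyp_similarity` (with the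
  region lemmas `pineauVicol_region_mem_nhds`, `….differentiableAt_pineauVicol`,
  `timeDerivOn_pineauVicol_region`: at interior times `timeDerivOn` is the genuine `∂ₜ`).
* **§9.3, first paragraph** (p. 33): the Type I bound (1.15) reads `‖U(y,s)‖ ≤ C_u/(1+‖y‖)`
  for `s ≥ 0`, `‖y‖ < e^{s/2}` ((9.4) with `k = 0`, on the whole cone `{|y| < e^{s/2}}`) —
  `norm_lerayOrbit_le_of_typeI_cone`; the pressure bound (1.16) reads `|P(y,s)| ≤ C_p e^{−s}`
  for `½e^{s/2} < ‖y‖ < ¾e^{s/2}`, `s ≥ 0` — `abs_lerayOrbitPressure_le_of_annulus`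
  ("From (1.16) and (9.1) we obtain that the pressure satisfies `|P(y,s)| ≤ C_p e^{−s}` …").
* **Lemma 9.2, the covering step** (p. 30): for `ε ∈ (0, ½]`, `(x,t) ∈ Q°_{1−ε}`,
  `c = min{ε/4, 1/6}`, `ρ = c(|x| + √(−t))`: `Q_{2ρ}(x,t) ⊂ Q₁` and `√(−t̃) + |x̃| ≥ ρ` on
  `Q_{2ρ}(x,t)`, whence `|u| ≤ C_u/ρ` there by (1.15) — `pineauVicol_lemma92_radius_pos`,
  `pineauVicol_lemma92_cylinder_subset`, `pineauVicol_lemma92_lower_bound`,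
  `pineauVicol_lemma92_velocity_bound` (the input of the interior-regularity Lemma 9.1 at scale
  `2ρ` with `A = 2C_u`).
* **Prop. 9.5, the glue (9.15)–(9.16)** (p. 33): `∫_{−r²}^0 dt/√(−t) = 2r`
  (`integral_inv_sqrt_neg`, `lintegral_Ioo_const_div_sqrt_neg`), hence slice bounds
  `∫_{B_r} F(t,·) ≤ K/√(−t)` on `(−r², 0)` for a space–time density `F` (there `F = |∇u|²`,
  `K = 5θ²_*`) give `∫∫_{Q_r} F ≤ 2Kr` and `r⁻¹∫∫_{Q_r} F ≤ 2K` — in particular for the tree's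
  CKN dissipation quantity `cknE r 0 G ≤ 2K` (`SuitableWeak.lean`), the input of the
  ε-regularity criterion at the top point (tree: `seregin2014_thm14_holds`) —
  `setLIntegral_parabolicCylinder_le_of_slice_bound`,
  `inv_mul_setLIntegral_parabolicCylinder_le_of_slice_bound`, `cknE_le_of_slice_bound`.
* **(9.1)–(9.2), the profile equations on the cone** (p. 29–30): the similarity transform of a
  classical solution on an open region `O` of the past is a classical solution, on `Φ⁻¹(O)`, of
  Navier–Stokes with Leray's drift force `−½(U + (y·∇)U)` (`rescaledEulerLerayForce 1 U`) —
  `IsClassicalNSSolutionOnRegion.lerayOrbit_preimage` (with the LOCAL Laplacian chain rule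
  `laplacian_lerayOrbit_of_contDiffOn`, slices being `C²` on open space sections only); for the
  region `[−1,0) × B₁` of Theorem 1.9 this is the backward Leray system (9.2) on the open cone
  `{s > 0, ‖y‖ < e^{s/2}} = Φ⁻¹((−1,0) × B₁)` (`ancientSimMap_preimage_Ioo_prod_ball`) —
  `IsClassicalNSSolutionOnRegion.pineauVicol_profile`, `….pineauVicol_profile_leray`.

Status. These are faithful transcriptions of elementary steps; the analytic core of the printed
proof — Lemma 9.1 (quantitative interior regularity of bounded solutions, Serrin), Lemma 9.4
(propagation of small vorticity), Prop. 9.5 (suitability of `(u,p)` on `Q_{3/4}` and the CKN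
criterion at the top point; tree: `seregin2014_thm14_holds`), Lemmas 5.3–5.4 (principal
Dirichlet eigenfunction of `L̄*` on `B_R̄`, Gaussian bound) and the Harnack step of §9.3 — is NOT
in this file, and `pineauVicol2026_oneSlice_regularity_holds` is not claimed.

## References

* B. Pineau, V. Vicol, *On rotated backwards self-similar solutions of the incompressible 3D
  Navier–Stokes equations*, arXiv:2607.09619 (2026): (1.15)–(1.17), Remark 1.10 with
  (1.18)–(1.19) (p. 8); §9, (9.1) (p. 29); Lemma 9.2 and its proof (p. 30); proof of Prop. 9.5,
  (9.15)–(9.16) (p. 33); §9.3, first paragraph (p. 33). [PineauVicol2026]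
* D. Chae, J. Wolf, Comm. PDE 42 (2017), §4 (the similarity variables). [ChaeWolf2017RemovingDSS]
-/

noncomputable section

open Set Metric Function Filter Topology MeasureTheory
open scoped ENNReal
open scoped Laplacian

namespace Literature.Analysis.FluidPDE

/-! ### (1.18): the self-similar time derivative -/

section SelfSimilarDeriv

variable {E : Type*} [NormedAddCommGroup E] [NormedSpace ℝ E]
variable {F : Type*} [NormedAddCommGroup F] [NormedSpace ℝ F]

/-- **Pineau–Vicol 2026, (1.18)** in similarity variables: if `uncurry u` is differentiable at
`(t, x) = (−e^{−s}, e^{−s/2} y)`, then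
`∂ₛU(y, s) = e^{−s/2} • (e^{−s} ∂ₜu(t,x) − ½ u(t,x) − ½ Du(t,x)[x])`, i.e.
`∂ₛU = √(−t)((−t)∂ₜu − ½u − ½(x·∇)u)` (from the tree's chain rule
`lerayOrbitForce_timeDeriv`: `∂ₛU + ½U + ½(y·∇)U = e^{−3s/2}∂ₜu`). [cite: PineauVicol2026, Remark 1.10 (1.18), arXiv:2607.09619 p. 8] -/
theorem timeDeriv_lerayOrbit_eq_selfSimilar {u : ℝ → E → F} {s : ℝ} {y : E}
    (h : DifferentiableAt ℝ (uncurry u) (-Real.exp (-s), Real.exp (-s / 2) • y)) :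
    timeDeriv (lerayOrbit u) s y =
      Real.exp (-s / 2) •
        (Real.exp (-s) • timeDeriv u (-Real.exp (-s)) (Real.exp (-s / 2) • y)
          - (1 / 2 : ℝ) • u (-Real.exp (-s)) (Real.exp (-s / 2) • y)
          - (1 / 2 : ℝ) • fderiv ℝ (u (-Real.exp (-s))) (Real.exp (-s / 2) • y)
              (Real.exp (-s / 2) • y)) := by
  have h' : DifferentiableAt ℝ (uncurry u) (ancientSimMap (s, y)) := by
    rwa [ancientSimMap_apply]
  have key := lerayOrbitForce_timeDeriv h'
  rw [fderiv_lerayOrbit, lerayOrbit_apply, lerayOrbitForce_apply, FunLike.coe_smul,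
    Pi.smul_apply, exp_neg_half_pow_three] at key
  rw [map_smul]
  set a : ℝ := Real.exp (-s / 2) with ha
  set b : ℝ := Real.exp (-s) with hb
  set T := timeDeriv u (-b) (a • y)
  set U₀ := u (-b) (a • y)
  set Dy := fderiv ℝ (u (-b)) (a • y) y
  have hab : b = a ^ 2 := (exp_neg_half_sq s).symm
  have e := eq_sub_of_add_eq (eq_sub_of_add_eq key)
  rw [e, hab]
  module

/-- **(1.18) in physical variables**: for `t < 0` and `uncurry u` differentiable at `(t, x)`,
`∂ₛU(y, s) = √(−t) • ((−t) ∂ₜu(t,x) − ½ u(t,x) − ½ Du(t,x)[x])` at `s = −log(−t)`,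
`y = x/√(−t)`. [cite: PineauVicol2026, Remark 1.10 (1.18), arXiv:2607.09619 p. 8] -/
theorem timeDeriv_lerayOrbit_neg_log {u : ℝ → E → F} {t : ℝ} (ht : t < 0) {x : E}
    (h : DifferentiableAt ℝ (uncurry u) (t, x)) :
    timeDeriv (lerayOrbit u) (-Real.log (-t)) ((Real.sqrt (-t))⁻¹ • x) =
      Real.sqrt (-t) • ((-t) • timeDeriv u t x - (1 / 2 : ℝ) • u t x
        - (1 / 2 : ℝ) • fderiv ℝ (u t) x x) := by
  have h0 : 0 < -t := by linarith
  have hs : 0 < Real.sqrt (-t) := Real.sqrt_pos.2 h0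
  have e1 : Real.exp (-(-Real.log (-t))) = -t := by rw [neg_neg, Real.exp_log h0]
  have e2 : Real.exp (-(-Real.log (-t)) / 2) = Real.sqrt (-t) := by
    rw [← sqrt_exp_neg, e1]
  have e3 : Real.sqrt (-t) • (Real.sqrt (-t))⁻¹ • x = x := by
    rw [smul_smul, mul_inv_cancel₀ hs.ne', one_smul]
  have key := @timeDeriv_lerayOrbit_eq_selfSimilar E _ _ F _ _ u (-Real.log (-t))
    ((Real.sqrt (-t))⁻¹ • x) (by rwa [e1, e2, e3, neg_neg])
  rwa [e1, e2, e3, neg_neg] at key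

end SelfSimilarDeriv

/-! ### (1.17) ⇒ (1.19) for the region of Theorem 1.9 -/

section OneSlice

/-- The region `[−1, 0) × B₁` of Theorem 1.9 is a neighbourhood of each of its points with
`−1 < t`. [folklore] -/
theorem pineauVicol_region_mem_nhds {t : ℝ} (ht1 : -1 < t) (ht0 : t < 0) {x : EuclideanSpace ℝ (Fin 3)}
    (hx : x ∈ ball (0 : EuclideanSpace ℝ (Fin 3)) 1) :
    Ico (-1 : ℝ) 0 ×ˢ ball (0 : EuclideanSpace ℝ (Fin 3)) 1 ∈ 𝓝 (t, x) :=
  mem_of_superset ((isOpen_Ioo.prod isOpen_ball).mem_nhds (mk_mem_prod ⟨ht1, ht0⟩ hx))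
    (prod_mono Ioo_subset_Ico_self Subset.rfl)

/-- For a classical solution on `[−1, 0) × B₁`, `uncurry u` is differentiable at every `(t, x)`
with `−1 < t < 0`, `‖x‖ < 1`. [folklore] -/
theorem IsClassicalNSSolutionOnRegion.differentiableAt_pineauVicol {u : ℝ → EuclideanSpace ℝ (Fin 3) → EuclideanSpace ℝ (Fin 3)}
    {p : ℝ → EuclideanSpace ℝ (Fin 3) → ℝ}
    (hreg : IsClassicalNSSolutionOnRegion (Ico (-1 : ℝ) 0 ×ˢ ball (0 : EuclideanSpace ℝ (Fin 3)) 1) 1 0 u p)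
    {t : ℝ} (ht1 : -1 < t) (ht0 : t < 0) {x : EuclideanSpace ℝ (Fin 3)} (hx : x ∈ ball (0 : EuclideanSpace ℝ (Fin 3)) 1) :
    DifferentiableAt ℝ (uncurry u) (t, x) :=
  ((hreg.smooth_velocity.contDiffAt (pineauVicol_region_mem_nhds ht1 ht0 hx)).differentiableAt
    (by simp))

/-- At interior times the time derivative within the region `[−1, 0) × B₁` is the genuine one:
`timeDerivOn Ω u t x = timeDeriv u t x` for `−1 < t < 0`, `‖x‖ < 1`. [folklore] -/
theorem timeDerivOn_pineauVicol_region (u : ℝ → EuclideanSpace ℝ (Fin 3) → EuclideanSpace ℝ (Fin 3)) {t : ℝ} (ht1 : -1 < t) (ht0 : t < 0)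
    {x : EuclideanSpace ℝ (Fin 3)} (hx : x ∈ ball (0 : EuclideanSpace ℝ (Fin 3)) 1) :
    timeDerivOn (Ico (-1 : ℝ) 0 ×ˢ ball (0 : EuclideanSpace ℝ (Fin 3)) 1) u t x = timeDeriv u t x := by
  rw [timeDeriv_apply]
  refine timeDerivOn_of_mem_nhds u ?_
  rw [timeSection_prod _ hx]
  exact mem_of_superset (isOpen_Ioo.mem_nhds ⟨ht1, ht0⟩) Ioo_subset_Ico_self

/-- **Pineau–Vicol 2026, (1.17) ⇒ (1.19)** ("Since `{|x| < 1}` corresponds to `{|y| < e^{s/2}}`,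
condition (1.17) at `t̄ = −e^{−s̄}` is precisely `‖∂ₛU(·, s̄)‖_{L^∞(B_{e^{s̄/2}})} ≤ δ₀`"): for a
classical solution on `[−1,0) × B₁`, a time `−1 < t̄ < 0` and the one-slice hypothesis of
`pineauVicol2026_oneSlice_regularity` at `t̄`, the profile `U = lerayOrbit u` satisfies
`‖∂ₛU(y, s̄)‖ ≤ δ₀` for every `‖y‖ < e^{s̄/2}`, where `s̄ = −log(−t̄)`. [cite: PineauVicol2026, Remark 1.10 (1.19), arXiv:2607.09619 p. 8] -/
theorem pineauVicol_oneSlice_hyp_similarity {u : ℝ → EuclideanSpace ℝ (Fin 3) → EuclideanSpace ℝ (Fin 3)} {p : ℝ → EuclideanSpace ℝ (Fin 3) → ℝ}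
    (hreg : IsClassicalNSSolutionOnRegion (Ico (-1 : ℝ) 0 ×ˢ ball (0 : EuclideanSpace ℝ (Fin 3)) 1) 1 0 u p)
    {tbar δ₀ : ℝ} (ht1 : -1 < tbar) (ht0 : tbar < 0)
    (hyp : ∀ x ∈ ball (0 : EuclideanSpace ℝ (Fin 3)) 1,
      ‖Real.sqrt (-tbar) •
          ((-tbar) • timeDerivOn (Ico (-1 : ℝ) 0 ×ˢ ball (0 : EuclideanSpace ℝ (Fin 3)) 1) u tbar x
            - (1 / 2 : ℝ) • u tbar x - (1 / 2 : ℝ) • fderiv ℝ (u tbar) x x)‖ ≤ δ₀)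
    {y : EuclideanSpace ℝ (Fin 3)} (hy : ‖y‖ < Real.exp (-Real.log (-tbar) / 2)) :
    ‖timeDeriv (lerayOrbit u) (-Real.log (-tbar)) y‖ ≤ δ₀ := by
  have h0 : 0 < -tbar := by linarith
  have hs : 0 < Real.sqrt (-tbar) := Real.sqrt_pos.2 h0
  -- the physical point `x = √(−t̄) y`
  set x : EuclideanSpace ℝ (Fin 3) := Real.sqrt (-tbar) • y with hx_def
  have e2 : Real.exp (-Real.log (-tbar) / 2) = (Real.sqrt (-tbar))⁻¹ := by
    rw [neg_div, Real.exp_neg, exp_log_neg_div_two ht0]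
  have hx : x ∈ ball (0 : EuclideanSpace ℝ (Fin 3)) 1 := by
    rw [mem_ball_zero_iff, hx_def, norm_smul, Real.norm_of_nonneg hs.le]
    calc Real.sqrt (-tbar) * ‖y‖ < Real.sqrt (-tbar) * Real.exp (-Real.log (-tbar) / 2) := by
          gcongr
      _ = 1 := by rw [e2, mul_inv_cancel₀ hs.ne']
  have hxy : (Real.sqrt (-tbar))⁻¹ • x = y := by
    rw [hx_def, smul_smul, inv_mul_cancel₀ hs.ne', one_smul]
  have key := timeDeriv_lerayOrbit_neg_log ht0 (hreg.differentiableAt_pineauVicol ht1 ht0 hx)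
  rw [hxy] at key
  rw [key, ← timeDerivOn_pineauVicol_region u ht1 ht0 hx]
  exact hyp x hx

end OneSlice

/-! ### §9.3, opening paragraph: the slice bounds in similarity variables -/

section SliceBounds

/-- `t = −e^{−s} ∈ [−1, 0)` for `s ≥ 0`. [folklore] -/
theorem neg_exp_neg_mem_Ico {s : ℝ} (hs : 0 ≤ s) : -Real.exp (-s) ∈ Ico (-1 : ℝ) 0 := by
  refine ⟨?_, by simpa using Real.exp_pos (-s)⟩
  have : Real.exp (-s) ≤ 1 := Real.exp_le_one_iff.2 (by linarith)
  linarith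

/-- `e^{−s/2} e^{s/2} = 1`. [folklore] -/
theorem exp_neg_half_mul_exp_half (s : ℝ) : Real.exp (-s / 2) * Real.exp (s / 2) = 1 := by
  rw [← Real.exp_add, show -s / 2 + s / 2 = 0 by ring, Real.exp_zero]

/-- **Type I bound (1.15) in similarity variables** ((9.4) with `k = 0`, on the whole cone; §9.3:
"For `s̄ ≥ s₀ ≥ 1`, `U(·, s̄)` satisfies the bound (9.4)"): if `‖u(t,x)‖ ≤ C_u/(√(−t) + ‖x‖)` on
`[−1,0) × B₁`, then `‖U(y, s)‖ ≤ C_u/(1 + ‖y‖)` for all `s ≥ 0` and `‖y‖ < e^{s/2}`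
(`U = lerayOrbit u`; `{|x| < 1}` corresponds to `{|y| < e^{s/2}}`, `t ∈ [−1,0)` to `s ≥ 0`). [cite: PineauVicol2026, §9.3 with (1.15), (9.1), (9.4), arXiv:2607.09619 p. 33] -/
theorem norm_lerayOrbit_le_of_typeI_cone
    {u : ℝ → EuclideanSpace ℝ (Fin 3) → EuclideanSpace ℝ (Fin 3)}
    {Cu : ℝ} (hI : ∀ t ∈ Ico (-1 : ℝ) 0, ∀ x ∈ ball 0 1, ‖u t x‖ ≤ Cu / (Real.sqrt (-t) + ‖x‖))
    {s : ℝ} (hs : 0 ≤ s) {y : EuclideanSpace ℝ (Fin 3)} (hy : ‖y‖ < Real.exp (s / 2)) :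
    ‖lerayOrbit u s y‖ ≤ Cu / (1 + ‖y‖) := by
  have ha : 0 < Real.exp (-s / 2) := Real.exp_pos _
  have hx : Real.exp (-s / 2) • y ∈ ball (0 : EuclideanSpace ℝ (Fin 3)) 1 := by
    rw [mem_ball_zero_iff, norm_smul, Real.norm_of_nonneg ha.le]
    calc Real.exp (-s / 2) * ‖y‖ < Real.exp (-s / 2) * Real.exp (s / 2) := by gcongr
      _ = 1 := exp_neg_half_mul_exp_half s
  have key := hI _ (neg_exp_neg_mem_Ico hs) _ hx
  rw [neg_neg, sqrt_exp_neg, norm_smul, Real.norm_of_nonneg ha.le, ← mul_one_add] at key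
  rw [lerayOrbit_apply, norm_smul, Real.norm_of_nonneg ha.le]
  calc Real.exp (-s / 2) * ‖u (-Real.exp (-s)) (Real.exp (-s / 2) • y)‖
      ≤ Real.exp (-s / 2) * (Cu / (Real.exp (-s / 2) * (1 + ‖y‖))) := by gcongr
    _ = Cu / (1 + ‖y‖) := by field_simp

/-- **Pressure bound (1.16) in similarity variables** (§9.3: "From (1.16) and (9.1) we obtain that
the pressure satisfies `|P(y, s)| ≤ C_p e^{−s}` for all `½e^{s/2} ≤ |y| ≤ ¾e^{s/2}`, and all
`s ≥ 0`"; here with the strict inequalities of (1.16), `A = {½ < |x| < ¾}`), for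
`P = lerayOrbitPressure p` (`P(y,s) = (−t) p(x,t)`, (9.1b)). [cite: PineauVicol2026, §9.3 with (1.16), (9.1), arXiv:2607.09619 p. 33] -/
theorem abs_lerayOrbitPressure_le_of_annulus {p : ℝ → EuclideanSpace ℝ (Fin 3) → ℝ} {Cp : ℝ}
    (hP : ∀ t ∈ Ico (-1 : ℝ) 0, ∀ x : EuclideanSpace ℝ (Fin 3),
      1 / 2 < ‖x‖ → ‖x‖ < 3 / 4 → |p t x| ≤ Cp)
    {s : ℝ} (hs : 0 ≤ s) {y : EuclideanSpace ℝ (Fin 3)} (hy1 : 1 / 2 * Real.exp (s / 2) < ‖y‖)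
    (hy2 : ‖y‖ < 3 / 4 * Real.exp (s / 2)) :
    |lerayOrbitPressure p s y| ≤ Cp * Real.exp (-s) := by
  have ha : 0 < Real.exp (-s / 2) := Real.exp_pos _
  have hb : 0 < Real.exp (-s) := Real.exp_pos _
  have hnorm : ‖Real.exp (-s / 2) • y‖ = Real.exp (-s / 2) * ‖y‖ := by
    rw [norm_smul, Real.norm_of_nonneg ha.le]
  have hx1 : 1 / 2 < ‖Real.exp (-s / 2) • y‖ := by
    rw [hnorm]
    calc (1 / 2 : ℝ) = Real.exp (-s / 2) * (1 / 2 * Real.exp (s / 2)) := by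
          rw [mul_left_comm, exp_neg_half_mul_exp_half, mul_one]
      _ < Real.exp (-s / 2) * ‖y‖ := by gcongr
  have hx2 : ‖Real.exp (-s / 2) • y‖ < 3 / 4 := by
    rw [hnorm]
    calc Real.exp (-s / 2) * ‖y‖ < Real.exp (-s / 2) * (3 / 4 * Real.exp (s / 2)) := by gcongr
      _ = 3 / 4 := by rw [mul_left_comm, exp_neg_half_mul_exp_half, mul_one]
  have key := hP _ (neg_exp_neg_mem_Ico hs) _ hx1 hx2
  rw [lerayOrbitPressure_apply, abs_mul, abs_of_pos hb, mul_comm]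
  gcongr

end SliceBounds

/-! ### Lemma 9.2: the covering step (cylinders `Q_{2ρ}(x,t) ⊂ Q₁` adapted to the Type I weight) -/

section Lemma92

variable {ε t : ℝ} {x : EuclideanSpace ℝ (Fin 3)}

/-- The radius of Lemma 9.2 is positive: `ρ = c(|x| + √(−t)) > 0` for `t < 0`,
`c = min{ε/4, 1/6}`, `ε > 0`. [cite: PineauVicol2026, proof of Lemma 9.2, arXiv:2607.09619 p. 30] -/
theorem pineauVicol_lemma92_radius_pos (hε : 0 < ε) (ht0 : t < 0) :
    0 < min (ε / 4) (1 / 6) * (‖x‖ + Real.sqrt (-t)) := by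
  have hc : 0 < min (ε / 4) (1 / 6) := lt_min (by linarith) (by norm_num)
  have : 0 < Real.sqrt (-t) := Real.sqrt_pos.2 (by linarith)
  positivity

/-- **Lemma 9.2, `Q_{2ρ}(x,t) ⊂ Q₁`** ("since `|x| + √(−t) ≤ 2` we have `2ρ ≤ 4c ≤ ε`, so
`B_{2ρ}(x) ⊂ B₁`, while `(2ρ)² ≤ ε² ≤ 1 − (1−ε)² ≤ 1 − (−t)`"): for `ε ∈ (0, ½]`,
`(x, t) ∈ Q°_{1−ε}` (`|x| < 1 − ε`, `−(1−ε)² < t < 0`) and `ρ = c(|x| + √(−t))`,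
`c = min{ε/4, 1/6}`, every `(t̃, x̃)` with `|x̃ − x| < 2ρ`, `t − (2ρ)² < t̃ ≤ t` lies in the
region `[−1, 0) × B₁` of Theorem 1.9 (indeed `−1 < t̃ < 0`). [cite: PineauVicol2026, proof of Lemma 9.2, arXiv:2607.09619 p. 30] -/
theorem pineauVicol_lemma92_cylinder_subset (hε : 0 < ε) (hε2 : ε ≤ 1 / 2) (hx : ‖x‖ < 1 - ε)
    (ht1 : -(1 - ε) ^ 2 < t) (ht0 : t < 0) {t' : ℝ} {x' : EuclideanSpace ℝ (Fin 3)}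
    (hx' : dist x' x < 2 * (min (ε / 4) (1 / 6) * (‖x‖ + Real.sqrt (-t))))
    (ht'1 : t - (2 * (min (ε / 4) (1 / 6) * (‖x‖ + Real.sqrt (-t)))) ^ 2 < t') (ht'0 : t' ≤ t) :
    -1 < t' ∧ t' < 0 ∧ x' ∈ ball (0 : EuclideanSpace ℝ (Fin 3)) 1 := by
  set c := min (ε / 4) (1 / 6) with hc_def
  have hc0 : 0 < c := lt_min (by linarith) (by norm_num)
  have hc4 : c ≤ ε / 4 := min_le_left _ _
  have hst : Real.sqrt (-t) ≤ 1 := by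
    rw [Real.sqrt_le_one]
    nlinarith
  -- `2ρ ≤ 4c ≤ ε`
  have h2ρ : 2 * (c * (‖x‖ + Real.sqrt (-t))) ≤ ε := by
    have : ‖x‖ + Real.sqrt (-t) ≤ 2 := by linarith
    nlinarith
  have hρ0 : 0 < c * (‖x‖ + Real.sqrt (-t)) := pineauVicol_lemma92_radius_pos hε ht0
  refine ⟨?_, lt_of_le_of_lt ht'0 ht0, ?_⟩
  · -- `(2ρ)² ≤ ε² ≤ 1 − (1−ε)² < 1 + t`
    have h1 : (2 * (c * (‖x‖ + Real.sqrt (-t)))) ^ 2 ≤ ε ^ 2 :=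
      pow_le_pow_left₀ (by positivity) h2ρ 2
    nlinarith
  · rw [mem_ball_zero_iff]
    calc ‖x'‖ ≤ ‖x‖ + dist x' x := by
          rw [dist_eq_norm]
          calc ‖x'‖ = ‖x + (x' - x)‖ := by rw [add_sub_cancel]
            _ ≤ ‖x‖ + ‖x' - x‖ := norm_add_le _ _
      _ < (1 - ε) + ε := by linarith
      _ = 1 := by ring

/-- **Lemma 9.2, the lower bound `√(−t̃) + |x̃| ≥ ρ` on `Q_{2ρ}(x,t)`** ("if `√(−t) ≥ |x|` then
`(−t̃)^{1/2} ≥ √(−t) ≥ ρ/(2c) ≥ ρ`, and if `√(−t) < |x|` then `|x̃| ≥ |x| − 2ρ ≥ ρ(1/(2c) − 2) ≥ ρ`").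
[cite: PineauVicol2026, proof of Lemma 9.2, arXiv:2607.09619 p. 30] -/
theorem pineauVicol_lemma92_lower_bound (hε : 0 < ε) {t' : ℝ} {x' : EuclideanSpace ℝ (Fin 3)}
    (hx' : dist x' x < 2 * (min (ε / 4) (1 / 6) * (‖x‖ + Real.sqrt (-t)))) (ht'0 : t' ≤ t) :
    min (ε / 4) (1 / 6) * (‖x‖ + Real.sqrt (-t)) ≤ Real.sqrt (-t') + ‖x'‖ := by
  set c := min (ε / 4) (1 / 6) with hc_def
  have hc0 : 0 < c := lt_min (by linarith) (by norm_num)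
  have hc6 : c ≤ 1 / 6 := min_le_right _ _
  have hsx : 0 ≤ Real.sqrt (-t') := Real.sqrt_nonneg _
  have hmono : Real.sqrt (-t) ≤ Real.sqrt (-t') := Real.sqrt_le_sqrt (by linarith)
  rcases le_or_gt ‖x‖ (Real.sqrt (-t)) with hle | hlt
  · -- `ρ ≤ 2c √(−t) ≤ √(−t) ≤ √(−t̃)`
    have : c * (‖x‖ + Real.sqrt (-t)) ≤ Real.sqrt (-t) := by nlinarith [Real.sqrt_nonneg (-t)]
    linarith [norm_nonneg x']
  · -- `|x̃| ≥ |x| − 2ρ ≥ ρ`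
    have hxx : ‖x‖ - dist x' x ≤ ‖x'‖ := by
      rw [dist_comm, dist_eq_norm]
      linarith [norm_sub_norm_le x x']
    have : 3 * (c * (‖x‖ + Real.sqrt (-t))) ≤ ‖x‖ := by nlinarith [Real.sqrt_nonneg (-t)]
    linarith

/-- **Lemma 9.2, the velocity bound on the small cylinder**: under (1.15) on `[−1,0) × B₁`, for
`ε ∈ (0, ½]`, `(x,t) ∈ Q°_{1−ε}`, `ρ = c(|x| + √(−t))`: `|u(x̃, t̃)| ≤ C_u/ρ` for all
`(x̃, t̃) ∈ Q_{2ρ}(x, t)` ("We deduce from (1.15) that `|u(x̃,t̃)| ≤ C_u/ρ` on `Q_{2ρ}(x,t)`";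
the input of Lemma 9.1 with `R = 2ρ`, `A = 2C_u`). [cite: PineauVicol2026, proof of Lemma 9.2, arXiv:2607.09619 p. 30] -/
theorem pineauVicol_lemma92_velocity_bound
    {u : ℝ → EuclideanSpace ℝ (Fin 3) → EuclideanSpace ℝ (Fin 3)}
    {Cu : ℝ} (hCu : 0 ≤ Cu)
    (hI : ∀ t ∈ Ico (-1 : ℝ) 0, ∀ x ∈ ball 0 1, ‖u t x‖ ≤ Cu / (Real.sqrt (-t) + ‖x‖))
    (hε : 0 < ε) (hε2 : ε ≤ 1 / 2) (hx : ‖x‖ < 1 - ε) (ht1 : -(1 - ε) ^ 2 < t) (ht0 : t < 0)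
    {t' : ℝ} {x' : EuclideanSpace ℝ (Fin 3)}
    (hx' : dist x' x < 2 * (min (ε / 4) (1 / 6) * (‖x‖ + Real.sqrt (-t))))
    (ht'1 : t - (2 * (min (ε / 4) (1 / 6) * (‖x‖ + Real.sqrt (-t)))) ^ 2 < t') (ht'0 : t' ≤ t) :
    ‖u t' x'‖ ≤ Cu / (min (ε / 4) (1 / 6) * (‖x‖ + Real.sqrt (-t))) := by
  obtain ⟨h1, h0, hball⟩ := pineauVicol_lemma92_cylinder_subset hε hε2 hx ht1 ht0 hx' ht'1 ht'0
  have hρ := pineauVicol_lemma92_radius_pos (x := x) hε ht0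
  calc ‖u t' x'‖ ≤ Cu / (Real.sqrt (-t') + ‖x'‖) := hI t' ⟨h1.le, h0⟩ x' hball
    _ ≤ Cu / (min (ε / 4) (1 / 6) * (‖x‖ + Real.sqrt (-t))) := by
        gcongr
        exact pineauVicol_lemma92_lower_bound hε hx' ht'0

end Lemma92

/-! ### Prop. 9.5: the scaling glue (9.15)–(9.16) towards the CKN criterion -/

section Prop95Glue

/-- `∫_{−r²}^{0} dt/√(−t) = 2r` for `r ≥ 0` ((9.16): "`(1/r)∫_{−r²}^0 (−t)^{−1/2} dt = 2`"). [cite: PineauVicol2026, (9.16), arXiv:2607.09619 p. 33] -/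
theorem integral_inv_sqrt_neg (r : ℝ) (hr : 0 ≤ r) :
    ∫ t in (-r ^ 2)..0, (Real.sqrt (-t))⁻¹ = 2 * r := by
  have h1 : ∫ t in (-r ^ 2)..0, (Real.sqrt (-t))⁻¹ = ∫ s in (0 : ℝ)..r ^ 2, (Real.sqrt s)⁻¹ := by
    have := intervalIntegral.integral_comp_neg (a := -r ^ 2) (b := 0) (fun s => (Real.sqrt s)⁻¹)
    simpa using this
  rw [h1]
  have h2 : ∫ s in (0 : ℝ)..r ^ 2, (Real.sqrt s)⁻¹ = ∫ s in (0 : ℝ)..r ^ 2, s ^ (-(1 / 2 : ℝ)) := by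
    refine intervalIntegral.integral_congr fun s hs => ?_
    have hs0 : 0 ≤ s := by
      rw [uIcc_of_le (by positivity)] at hs
      exact hs.1
    rw [Real.sqrt_eq_rpow, Real.rpow_neg hs0]
  rw [h2, integral_rpow (Or.inl (by norm_num))]
  have h3 : (r ^ 2) ^ (-(1 / 2 : ℝ) + 1) = r := by
    rw [show (-(1 / 2 : ℝ) + 1) = 1 / 2 by norm_num, ← Real.sqrt_eq_rpow, Real.sqrt_sq hr]
  rw [h3, Real.zero_rpow (by norm_num)]
  ring

/-- `∫⁻_{(−r², 0)} K/√(−t) dt = 2Kr` in `ℝ≥0∞`, for `K, r ≥ 0`. [folklore] -/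
theorem lintegral_Ioo_const_div_sqrt_neg {r K : ℝ} (hr : 0 ≤ r) (hK : 0 ≤ K) :
    ∫⁻ t in Ioo (-r ^ 2) 0, ENNReal.ofReal (K / Real.sqrt (-t)) = ENNReal.ofReal (2 * K * r) := by
  have hle : -r ^ 2 ≤ (0 : ℝ) := by
    have := sq_nonneg r
    linarith
  -- integrability of `t ↦ (√(−t))⁻¹` on `(−r², 0)`
  have hint : IntervalIntegrable (fun t : ℝ => (Real.sqrt (-t))⁻¹) volume (-r ^ 2) 0 := by
    have h0 : IntervalIntegrable (fun s : ℝ => s ^ (-(1 / 2 : ℝ))) volume 0 (r ^ 2) :=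
      intervalIntegral.intervalIntegrable_rpow' (by norm_num)
    have h1 : IntervalIntegrable (fun s : ℝ => (Real.sqrt s)⁻¹) volume 0 (r ^ 2) := by
      refine h0.congr fun s hs => ?_
      have hs0 : 0 ≤ s := by
        rw [uIoc_of_le (by positivity)] at hs
        exact hs.1.le
      rw [Real.sqrt_eq_rpow, Real.rpow_neg hs0]
    have h2 := (h1.comp_sub_left 0).symm
    simp only [zero_sub, sub_zero] at h2
    exact h2
  have hint' : IntegrableOn (fun t : ℝ => K / Real.sqrt (-t)) (Ioo (-r ^ 2) 0) volume := by
    have h : IntegrableOn (fun t : ℝ => K * (Real.sqrt (-t))⁻¹) (Ioc (-r ^ 2) 0) volume :=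
      hint.1.const_mul K
    rw [integrableOn_Ioc_iff_integrableOn_Ioo] at h
    refine h.congr_fun (fun t _ => ?_) measurableSet_Ioo
    simp [div_eq_mul_inv]
  rw [← ofReal_integral_eq_lintegral_ofReal hint']
  · congr 1
    rw [← integral_Ioc_eq_integral_Ioo, ← intervalIntegral.integral_of_le hle]
    simp_rw [div_eq_mul_inv]
    rw [intervalIntegral.integral_const_mul, integral_inv_sqrt_neg r hr]
    ring
  · exact ae_of_all _ fun t => div_nonneg hK (Real.sqrt_nonneg _)

/-- **The CKN glue of Prop. 9.5 ((9.15)–(9.16))**: if a nonnegative space–time density `F`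
(in the application `F = |∇u|²`) satisfies the slice bounds `∫_{B_r} F(t, ·) ≤ K/√(−t)` for all
`t ∈ (−r², 0)`, then `∫∫_{Q_r} F ≤ 2Kr`, `Q_r = (−r², 0) × B_r` the backward parabolic cylinder at
the origin ("Using the bound (9.15) we may then compute `(1/r)∫_{Q_r}|∇u|² ≤ 5θ²·(1/r)∫_{−r²}^0
(−t)^{−1/2} dt = 10θ²`"). [cite: PineauVicol2026, proof of Prop. 9.5, (9.15)–(9.16), arXiv:2607.09619 p. 33] -/
theorem setLIntegral_parabolicCylinder_le_of_slice_bound {F : ℝ × EuclideanSpace ℝ (Fin 3) → ℝ≥0∞}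
    {r K : ℝ} (hr : 0 ≤ r) (hK : 0 ≤ K)
    (hF : AEMeasurable F
      (volume.restrict (parabolicCylinder r (0 : ℝ × EuclideanSpace ℝ (Fin 3)))))
    (hslice : ∀ t ∈ Ioo (-r ^ 2) 0, ∫⁻ x in ball (0 : EuclideanSpace ℝ (Fin 3)) r, F (t, x) ≤
      ENNReal.ofReal (K / Real.sqrt (-t))) :
    ∫⁻ z in parabolicCylinder r (0 : ℝ × EuclideanSpace ℝ (Fin 3)), F z ≤
      ENNReal.ofReal (2 * K * r) := by
  have hset : parabolicCylinder r (0 : ℝ × EuclideanSpace ℝ (Fin 3)) =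
      Ioo (-r ^ 2) 0 ×ˢ ball (0 : EuclideanSpace ℝ (Fin 3)) r := by
    simp [parabolicCylinder]
  have hμ : (volume.restrict (parabolicCylinder r (0 : ℝ × EuclideanSpace ℝ (Fin 3))) :
        Measure (ℝ × EuclideanSpace ℝ (Fin 3))) =
      (volume.restrict (Ioo (-r ^ 2) 0)).prod
        (volume.restrict (ball (0 : EuclideanSpace ℝ (Fin 3)) r)) := by
    rw [hset, Measure.volume_eq_prod, Measure.prod_restrict]
  rw [hμ] at hF ⊢
  rw [lintegral_prod _ hF, ← lintegral_Ioo_const_div_sqrt_neg hr hK]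
  refine setLIntegral_mono_ae' measurableSet_Ioo (ae_of_all _ fun t ht => ?_)
  exact hslice t ht

/-- **(9.16) in the scaled form**: under the slice bounds of
`setLIntegral_parabolicCylinder_le_of_slice_bound` with `r > 0`,
`r⁻¹ ∫∫_{Q_r} F ≤ 2K` (for `F = |∇u|²` this is the CKN quantity `E(r) = cknE r 0 ∇u ≤ 2K`). [cite: PineauVicol2026, proof of Prop. 9.5, (9.16), arXiv:2607.09619 p. 33] -/
theorem inv_mul_setLIntegral_parabolicCylinder_le_of_slice_bound
    {F : ℝ × EuclideanSpace ℝ (Fin 3) → ℝ≥0∞} {r K : ℝ} (hr : 0 < r) (hK : 0 ≤ K)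
    (hF : AEMeasurable F
      (volume.restrict (parabolicCylinder r (0 : ℝ × EuclideanSpace ℝ (Fin 3)))))
    (hslice : ∀ t ∈ Ioo (-r ^ 2) 0, ∫⁻ x in ball (0 : EuclideanSpace ℝ (Fin 3)) r, F (t, x) ≤
      ENNReal.ofReal (K / Real.sqrt (-t))) :
    (ENNReal.ofReal r)⁻¹ * ∫⁻ z in parabolicCylinder r (0 : ℝ × EuclideanSpace ℝ (Fin 3)), F z ≤
      ENNReal.ofReal (2 * K) := by
  have h := setLIntegral_parabolicCylinder_le_of_slice_bound hr.le hK hF hslice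
  have hr0 : ENNReal.ofReal r ≠ 0 := by simpa using hr
  calc (ENNReal.ofReal r)⁻¹ * ∫⁻ z in parabolicCylinder r (0 : ℝ × EuclideanSpace ℝ (Fin 3)), F z
      ≤ (ENNReal.ofReal r)⁻¹ * ENNReal.ofReal (2 * K * r) := by gcongr
    _ = ENNReal.ofReal (2 * K) := by
        rw [show 2 * K * r = r * (2 * K) by ring, ENNReal.ofReal_mul hr.le, ← mul_assoc,
          ENNReal.inv_mul_cancel hr0 ENNReal.ofReal_ne_top, one_mul]

/-- The same for the tree's scaled dissipation `cknE r 0 G = r⁻¹ ∫∫_{Q_r} |G|²` of a (weak)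
gradient field `G` (`SuitableWeak.lean`): slice bounds `∫_{B_r} |G(t,·)|² ≤ K/√(−t)` on
`(−r², 0)` give `E(r) ≤ 2K`. [cite: PineauVicol2026, proof of Prop. 9.5, (9.16), arXiv:2607.09619 p. 33] -/
theorem cknE_le_of_slice_bound
    {G : ℝ → EuclideanSpace ℝ (Fin 3) → EuclideanSpace ℝ (Fin 3) →L[ℝ] EuclideanSpace ℝ (Fin 3)}
    {r K : ℝ} (hr : 0 < r) (hK : 0 ≤ K)
    (hG : AEMeasurable
      (fun z : ℝ × EuclideanSpace ℝ (Fin 3) => ENNReal.ofReal (frobeniusNormSq (G z.1 z.2)))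
      (volume.restrict (parabolicCylinder r (0 : ℝ × EuclideanSpace ℝ (Fin 3)))))
    (hslice : ∀ t ∈ Ioo (-r ^ 2) 0,
      ∫⁻ x in ball (0 : EuclideanSpace ℝ (Fin 3)) r, ENNReal.ofReal (frobeniusNormSq (G t x)) ≤
        ENNReal.ofReal (K / Real.sqrt (-t))) :
    cknE r (0 : ℝ × EuclideanSpace ℝ (Fin 3)) G ≤ ENNReal.ofReal (2 * K) :=
  inv_mul_setLIntegral_parabolicCylinder_le_of_slice_bound
    (F := fun z : ℝ × EuclideanSpace ℝ (Fin 3) => ENNReal.ofReal (frobeniusNormSq (G z.1 z.2)))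
    hr hK hG hslice

end Prop95Glue

/-! ### (9.2): the profile equations on the cone `{(y, s) : |y| < e^{s/2}}` -/

section Cone

variable {E : Type*} [NormedAddCommGroup E] [InnerProductSpace ℝ E] [FiniteDimensional ℝ E]

/-- **Local Laplacian chain rule for the similarity transform**: if the slice `u(t, ·)`,
`t = −e^{−s}`, is `C²` on an open set `S ∋ e^{−s/2} y`, then `ΔU(s, y) = e^{−3s/2} Δu(t, x)` at
`x = e^{−s/2} y`, i.e. `ΔU = lerayOrbitForce (Δu)` there (the tree's `laplacian_lerayOrbit` asks
for a globally `C²` slice; here the slice is localised with `laplacian_comp_affine_of_contDiffOn`).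
[folklore] -/
theorem laplacian_lerayOrbit_of_contDiffOn {F' : Type*} [NormedAddCommGroup F']
    [InnerProductSpace ℝ F'] {u : ℝ → E → F'} {s : ℝ} {y : E} {S : Set E} (hS : IsOpen S)
    (hu : ContDiffOn ℝ 2 (u (-Real.exp (-s))) S) (hy : Real.exp (-s / 2) • y ∈ S) :
    (Δ (lerayOrbit u s)) y = lerayOrbitForce (fun t x => (Δ (u t)) x) s y := by
  have hy' : (0 : E) + Real.exp (-s / 2) • y ∈ S := by rwa [zero_add]
  have h1 : lerayOrbit u s =
      Real.exp (-s / 2) • fun z => u (-Real.exp (-s)) ((0 : E) + Real.exp (-s / 2) • z) := by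
    funext z
    simp only [lerayOrbit_apply, Pi.smul_apply, zero_add]
  have h2 : ContDiffAt ℝ 2 (fun z : E => u (-Real.exp (-s)) ((0 : E) + Real.exp (-s / 2) • z)) y :=
    (hu.contDiffAt (hS.mem_nhds hy')).comp y (by fun_prop)
  rw [lerayOrbitForce_apply, h1, InnerProductSpace.laplacian_smul _ h2,
    laplacian_comp_affine_of_contDiffOn hu hS 0 (Real.exp (-s / 2)) hy', zero_add, smul_smul,
    ← pow_succ', show (2 + 1 : ℕ) = 3 from rfl]

/-- **The similarity transform of a classical solution on an open region of the past is a
classical solution of the backward Leray system on the transformed region** ((9.2): "on this set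
it solves the time-dependent self-similar Navier–Stokes system
`∂ₛU + ½U + ½(y·∇)U − ΔU + (U·∇)U + ∇P = 0`, `∇·U = 0`"; Chae–Wolf 2017, §4): for an open
`O ⊆ ℝ × E` and a classical solution `(u, p)` of the unforced Navier–Stokes system with viscosity
`ν` on `O`, the profiles `(U, P) = (lerayOrbit u, lerayOrbitPressure p)` form a classical solution,
on the open region `Φ⁻¹(O)` (`Φ(s, y) = (−e^{−s}, e^{−s/2} y)`), of the Navier–Stokes system with
viscosity `ν` and Leray's drift force `−½(U + (y·∇)U)` (`rescaledEulerLerayForce 1 U`) — the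
region form of the tree's slab equivalence
`isClassicalNSSolutionOn_iff_isBackwardLeraySolutionOn_lerayOrbit`. [cite: PineauVicol2026, §9 (9.1)–(9.2), arXiv:2607.09619 p. 29–30] -/
theorem IsClassicalNSSolutionOnRegion.lerayOrbit_preimage {O : Set (ℝ × E)} (hO : IsOpen O)
    {ν : ℝ} {u : ℝ → E → E} {p : ℝ → E → ℝ} (h : IsClassicalNSSolutionOnRegion O ν 0 u p) :
    IsClassicalNSSolutionOnRegion (ancientSimMap ⁻¹' O) ν
      (rescaledEulerLerayForce 1 (lerayOrbit u)) (lerayOrbit u) (lerayOrbitPressure p) where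
  smooth_velocity := by
    rw [uncurry_lerayOrbit]
    exact contDiff_exp_neg_fst_half.contDiffOn.smul
      (h.smooth_velocity.comp contDiff_ancientSimMap.contDiffOn (mapsTo_preimage _ _))
  smooth_pressure := by
    rw [uncurry_lerayOrbitPressure]
    exact contDiff_exp_neg_fst.contDiffOn.mul
      (h.smooth_pressure.comp contDiff_ancientSimMap.contDiffOn (mapsTo_preimage _ _))
  momentum s y hsy := by
    have hO' : IsOpen (ancientSimMap ⁻¹' O) := hO.preimage continuous_ancientSimMap
    have htx : (-Real.exp (-s), Real.exp (-s / 2) • y) ∈ O := by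
      simpa only [mem_preimage, ancientSimMap_apply] using hsy
    have hd : DifferentiableAt ℝ (uncurry u) (ancientSimMap (s, y)) := by
      rw [ancientSimMap_apply]
      exact (h.contDiffAt_velocity hO htx).differentiableAt (by simp)
    have hΔ := laplacian_lerayOrbit_of_contDiffOn (isOpen_spaceSection hO _)
      ((h.contDiffOn_velocity (-Real.exp (-s))).of_le (WithTop.coe_le_coe.2 le_top))
      (mem_spaceSection.2 htx)
    have hm := h.momentum_deriv hO htx
    rw [timeDerivOn_of_isOpen hO' _ hsy, ← timeDeriv_apply, rescaledEulerLerayForce_apply,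
      ← leray_momentum_iff, lerayOrbitForce_timeDeriv hd, convect_lerayOrbit, hΔ,
      gradient_lerayOrbitPressure]
    simp only [lerayOrbitForce_apply]
    simp only [← timeDeriv_apply, Pi.zero_apply, add_zero] at hm
    set a : ℝ := Real.exp (-s / 2)
    set T := timeDeriv u (-Real.exp (-s)) (a • y)
    set C := convect (u (-Real.exp (-s))) (u (-Real.exp (-s))) (a • y)
    set G := gradient (p (-Real.exp (-s))) (a • y)
    set D := (Δ (u (-Real.exp (-s)))) (a • y)
    have hm' : T + C + G = ν • D := by rw [hm]; abel
    calc a ^ 3 • T + a ^ 3 • C + a ^ 3 • G = a ^ 3 • (T + C + G) := by module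
      _ = ν • a ^ 3 • D := by rw [hm', smul_comm]
  divFree s y hsy := by
    have htx : (-Real.exp (-s), Real.exp (-s / 2) • y) ∈ O := by
      simpa only [mem_preimage, ancientSimMap_apply] using hsy
    rw [divergence_lerayOrbit, h.divFree _ _ htx, mul_zero]

omit [FiniteDimensional ℝ E] in
/-- **The cone of (9.2)**: the similarity variables map `{s > 0, |y| < e^{s/2}}` onto the open
cylinder `(−1, 0) × B₁`: `Φ⁻¹((−1,0) × B₁) = {(s, y) | 0 < s ∧ ‖y‖ < e^{s/2}}` ("It follows that
`(U, P)` is well-defined on the set `{(y,s) ∈ ℝ³ × [0,∞) : |y| < e^{s/2}}`", here its interior).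
[cite: PineauVicol2026, §9 after (9.1), arXiv:2607.09619 p. 30] -/
theorem ancientSimMap_preimage_Ioo_prod_ball :
    ancientSimMap ⁻¹' (Ioo (-1 : ℝ) 0 ×ˢ ball (0 : E) 1) =
      {z : ℝ × E | 0 < z.1 ∧ ‖z.2‖ < Real.exp (z.1 / 2)} := by
  ext ⟨s, y⟩
  have ha : 0 < Real.exp (-s / 2) := Real.exp_pos _
  simp only [mem_preimage, ancientSimMap_apply, mem_prod, mem_Ioo, mem_ball_zero_iff, mem_setOf_eq,
    neg_lt_neg_iff, Real.exp_lt_one_iff, neg_lt_zero, Real.exp_pos, and_true, norm_smul,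
    Real.norm_of_nonneg ha.le]
  refine and_congr (by constructor <;> intro h <;> linarith) ⟨fun h => ?_, fun h => ?_⟩
  · calc ‖y‖ = Real.exp (s / 2) * (Real.exp (-s / 2) * ‖y‖) := by
          rw [← mul_assoc, mul_comm (Real.exp (s / 2)), exp_neg_half_mul_exp_half, one_mul]
      _ < Real.exp (s / 2) * 1 := by gcongr
      _ = Real.exp (s / 2) := mul_one _
  · calc Real.exp (-s / 2) * ‖y‖ < Real.exp (-s / 2) * Real.exp (s / 2) := by gcongr
      _ = 1 := exp_neg_half_mul_exp_half s

/-- **(9.2) for the solutions of Theorem 1.9**: for a classical solution `(u, p)` of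
Navier–Stokes (`ν = 1`, `f = 0`) on the region `[−1,0) × B₁`, the profiles
`(U, P) = (lerayOrbit u, lerayOrbitPressure p)` form a classical solution of the backward Leray
system (Navier–Stokes with Leray's drift force `−½(U + (y·∇)U)`, `ν = 1`) on the open cone
`{(s, y) | s > 0, ‖y‖ < e^{s/2}}`. [cite: PineauVicol2026, §9 (9.1)–(9.2), arXiv:2607.09619 p. 29–30] -/
theorem IsClassicalNSSolutionOnRegion.pineauVicol_profile {u : ℝ → E → E} {p : ℝ → E → ℝ}
    (hreg : IsClassicalNSSolutionOnRegion (Ico (-1 : ℝ) 0 ×ˢ ball (0 : E) 1) 1 0 u p) :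
    IsClassicalNSSolutionOnRegion {z : ℝ × E | 0 < z.1 ∧ ‖z.2‖ < Real.exp (z.1 / 2)} 1
      (rescaledEulerLerayForce 1 (lerayOrbit u)) (lerayOrbit u) (lerayOrbitPressure p) := by
  rw [← ancientSimMap_preimage_Ioo_prod_ball]
  exact (hreg.mono_of_isOpen (prod_mono Ioo_subset_Ico_self Subset.rfl)
    (isOpen_Ioo.prod isOpen_ball)).lerayOrbit_preimage (isOpen_Ioo.prod isOpen_ball)

/-- **(9.2a) in Leray's form on the cone**: under the hypotheses of
`IsClassicalNSSolutionOnRegion.pineauVicol_profile`, at every `s > 0`, `‖y‖ < e^{s/2}`,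
`∂ₛU + ½U + ½(y·∇)U + (U·∇)U + ∇P = ΔU` with the genuine `∂ₛ` (`timeDeriv`), and `div U = 0`
((9.2b)). [cite: PineauVicol2026, (9.2), arXiv:2607.09619 p. 30] -/
theorem IsClassicalNSSolutionOnRegion.pineauVicol_profile_leray {u : ℝ → E → E} {p : ℝ → E → ℝ}
    (hreg : IsClassicalNSSolutionOnRegion (Ico (-1 : ℝ) 0 ×ˢ ball (0 : E) 1) 1 0 u p)
    {s : ℝ} (hs : 0 < s) {y : E} (hy : ‖y‖ < Real.exp (s / 2)) :
    timeDeriv (lerayOrbit u) s y + (1 / 2 : ℝ) • lerayOrbit u s y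
        + (1 / 2 : ℝ) • fderiv ℝ (lerayOrbit u s) y y
        + convect (lerayOrbit u s) (lerayOrbit u s) y + gradient (lerayOrbitPressure p s) y =
      (1 : ℝ) • (Δ (lerayOrbit u s)) y ∧
    VectorCalculus.divergence (lerayOrbit u s) y = 0 := by
  have h := hreg.pineauVicol_profile
  have hO : IsOpen {z : ℝ × E | 0 < z.1 ∧ ‖z.2‖ < Real.exp (z.1 / 2)} := by
    rw [← ancientSimMap_preimage_Ioo_prod_ball]
    exact (isOpen_Ioo.prod isOpen_ball).preimage continuous_ancientSimMap
  have hsy : (s, y) ∈ {z : ℝ × E | 0 < z.1 ∧ ‖z.2‖ < Real.exp (z.1 / 2)} := ⟨hs, hy⟩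
  refine ⟨(leray_momentum_iff _ _ _ _ _ _).2 ?_, h.divFree s y hsy⟩
  have hm := h.momentum_deriv hO hsy
  rwa [← timeDeriv_apply, rescaledEulerLerayForce_apply] at hm

end Cone

end Literature.Analysis.FluidPDE

end
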